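import Mathlib
import Summits.Ventures.PercRepro2.HCov
import Summits.Ventures.PercRepro2.RootLeafUHalf
import Summits.Ventures.PercRepro2.RootLeafUTheorem
import Summits.Ventures.PercRepro2.RootLeafUMixK
import Summits.Ventures.PercRepro2.RootLeafUMixKA
import Summits.Ventures.PercRepro2.RootLeafUMixL
import Summits.Ventures.PercRepro2.RootLeafUMixLA
import Summits.Ventures.PercRepro2.RootLeafUMixSum

/-!
# (G4-u): THE SECOND (MARGINAL) LOWER BOUNDS of the two halves of `T2` — part 1 of the max-of-two
criterion (the criterion itself and (G4-u) on its class are in RootLeafUMixMaxThm)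
(blind cell PercRepro2, p4 g14; S3 item (aa); no definitions)

RootLeafUMixSum bounds each half of `T2` from below by the ρ = 1 BHK step: `lowK ≤ P₀·T2oK`,
`lowL ≤ W·T2oL`.  That step is TIGHT when the mixed covariance `Cov(1_{c ∈ other}·1_{b ∈ mine}, 1_{o ∈ mine})`
is as negative as `−Cov(1_{c ∉ other}, 1_{o ∈ mine})`, and LOOSE when the mixed events are nearly
incompatible (e.g. the star with centre `o`: `c ∈ L` forces `o ∈ L`, so the mixed covariance vanishes).
In that regime the TRIVIAL bound `Cov(X, Y) ≥ −E[X]·E[Y]` on the mixed term is sharp.  Dropping the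
nonnegative joint mass and the BHK-1.4 slack of `b` on the other side (`bL_mul_P0_le`, `YbK_mul_W_le`) gives
the second, MARGINAL lower bounds (no `b`–`o` joint mass appears in them):

  `lowK₂ := A·ℋ′ − 2β·P(T′, bK)·P_o + ℰ·(e0P₀ − d0P_o) ≤ P₀·T2oK`   (`lowK2_le_P0_mul_T2oK`),
  `lowL₂ := |B|·δ_o − 2β·P(T, bL)·Y + (OU)·Y ≤ W·T2oL`             (`lowL2_le_W_mul_T2oL`),

valid in every case in division form (`lowK2_div_le_T2oK`, `lowL2_div_le_T2oL`); RootLeafUMixMaxThm then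
proves **`T2_nonneg_of_max_criterion`**: `0 ≤ max (lowK/P₀) (lowK₂/P₀) + max (lowL/W) (lowL₂/W) → 0 ≤ T2` and
**`HCov_root_leaf_u_of_max_criterion`** ((G4-u) on that class).

The class contains the sum class of RootLeafUMixSum (each `max` is `≥` its first argument).  Census (own code
sumclass3.py, 900 random instances n ≤ 7, three palettes, exact): the sum criterion 88.3 / 83.3 / 82.3 %,
the max-of-two criterion 98.3 / 95.7 / 98.0 %; per side `max(lowL, lowL₂) ≥ 0` on 300 / 299 / 300 and
`max(lowK, lowK₂) ≥ 0` on 289 / 282 / 284 of 300 — the `o ∈ L` half is a theorem on essentially every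
random instance from marginal masses alone.  Notation as in RootLeafUMixSum.
-/

namespace Summit.Ventures.PercRepro2

open UnionCluster CovForm

namespace RootLeafU

namespace MixK

variable {V : Type*} {E : Type*} [Fintype E] [DecidableEq E] [Fintype V] [DecidableEq V]
  {R : Type*} [Field R] [LinearOrder R] [IsStrictOrderedRing R]

section SecondBound

variable (p : E → R) (ends : E → Sym2 V) (o a₂ c b u : V)

/-- **BHK06 Thm 1.4 at `(a₂, u)` avoiding `{u, c}`**: `[P(PD, oK, bL) + P(T′, oK, bL)]·P₀ ≤ P_o·[P(PD, bL) + P(T′, bL)]`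
(`o ∈ K` against `b ∈ L` under `P(· | K avoids {u, c})`), in `PD`/`T′` masses. -/
theorem bL_mul_P0_le (hp : IsProbVec p) :
    (prob p (PDEvent ends u a₂ c ∩ (connEvent ends a₂ o ∩ connEvent ends u b)) +
        prob p (TEvent ends a₂ u c ∩ (connEvent ends a₂ o ∩ connEvent ends u b))) *
      (prob p (PDEvent ends u a₂ c) + prob p (TEvent ends a₂ u c)) ≤
    (prob p (PDEvent ends u a₂ c ∩ connEvent ends a₂ o) + prob p (TEvent ends a₂ u c ∩ connEvent ends a₂ o)) *
      (prob p (PDEvent ends u a₂ c ∩ connEvent ends u b) + prob p (TEvent ends a₂ u c ∩ connEvent ends u b)) := by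
  classical
  have hU : IsUpperSet ({W : Set V | o ∈ W}) := fun _ _ h ho => h ho
  have hV : IsUpperSet ({W : Set V | b ∈ W}) := fun _ _ h hb => h hb
  have hu : u ∈ ({u, c} : Finset V) := by simp
  have f5 := bhk_cross_cluster_avoid p hp ends a₂ u hu hU hV
  rw [ExploreA3.clusterInEvent_mem_eq, ExploreA3.clusterInEvent_mem_eq] at f5
  have e5a : connEvent ends a₂ o ∩ connEvent ends u b ∩ avoidAll ends a₂ {u, c} =
      avoidAll ends a₂ {u, c} ∩ (connEvent ends a₂ o ∩ connEvent ends u b) := Set.inter_comm _ _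
  have e5b : connEvent ends a₂ o ∩ avoidAll ends a₂ {u, c} =
      avoidAll ends a₂ {u, c} ∩ connEvent ends a₂ o := Set.inter_comm _ _
  have e5c : connEvent ends u b ∩ avoidAll ends a₂ {u, c} =
      avoidAll ends a₂ {u, c} ∩ connEvent ends u b := Set.inter_comm _ _
  rw [e5a, e5b, e5c] at f5
  have hN := prob_N_inter p ends a₂ c u Set.univ
  simp only [Set.inter_univ] at hN
  have hO := prob_N_inter p ends a₂ c u (connEvent ends a₂ o)
  have hOB := prob_N_inter p ends a₂ c u (connEvent ends a₂ o ∩ connEvent ends u b)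
  have hB := prob_N_inter p ends a₂ c u (connEvent ends u b)
  rw [hN, hO, hOB, hB] at f5
  linarith [f5]

/-- **The second (marginal) lower bound of the `o ∈ K` half**: `lowK₂ = A·ℋ′ − 2β·P(T′, bK)·P_o + ℰ·(e0P₀ − d0P_o)
≤ P₀·T2oK` — the master identity with the joint mass `P(T′, bK, oK)·P₀ ≥ 0` and the BHK-1.4 slack of `b ∈ L`
(`bL_mul_P0_le`) dropped from `X_b`. -/
theorem lowK2_le_P0_mul_T2oK (hp : IsProbVec p) :
    ((prob p (PDEvent ends u a₂ c) * prob p (connEvent ends a₂ b) +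
            prob p (avoidAll ends a₂ {c}) * gap p ends u a₂ b) +
          (prob p Set.univ * EQb3 p ends u a₂ c b + prob p Set.univ * PDb p ends u a₂ c b +
            prob p (connEvent ends a₂ b) * EQ3 p ends u a₂ c +
            prob p (connEvent ends a₂ b) * prob p (avoidAll ends a₂ {u}) -
            (prob p Set.univ - prob p (avoidAll ends a₂ {c})) * gap p ends u a₂ b)) *
        (prob p (TEvent ends a₂ u c) * prob p (PDEvent ends u a₂ c ∩ connEvent ends a₂ o) -
          prob p (PDEvent ends u a₂ c) * prob p (TEvent ends a₂ u c ∩ connEvent ends a₂ o)) -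
      2 * (prob p Set.univ * prob p (PDEvent ends u a₂ c) +
          prob p (avoidAll ends a₂ {c}) * prob p (avoidAll ends a₂ {u})) *
        (prob p (TEvent ends a₂ u c ∩ connEvent ends a₂ b) *
          (prob p (PDEvent ends u a₂ c ∩ connEvent ends a₂ o) +
            prob p (TEvent ends a₂ u c ∩ connEvent ends a₂ o))) +
      Ee p ends a₂ c b u *
        (prob p (avoidAll ends a₂ {c} ∩ connEvent ends a₂ o) *
            (prob p (PDEvent ends u a₂ c) + prob p (TEvent ends a₂ u c)) -
          prob p (avoidAll ends a₂ {c}) *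
            (prob p (PDEvent ends u a₂ c ∩ connEvent ends a₂ o) +
              prob p (TEvent ends a₂ u c ∩ connEvent ends a₂ o))) ≤
    (prob p (PDEvent ends u a₂ c) + prob p (TEvent ends a₂ u c)) * T2oK p ends o a₂ c b u := by
  have hid := P0_mul_T2oK_eq p ends o a₂ c b u
  have hbL := bL_mul_P0_le p ends o a₂ c b u hp
  have hβ : 0 ≤ prob p Set.univ * prob p (PDEvent ends u a₂ c) +
      prob p (avoidAll ends a₂ {c}) * prob p (avoidAll ends a₂ {u}) :=
    add_nonneg (mul_nonneg (prob_nonneg hp _) (prob_nonneg hp _))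
      (mul_nonneg (prob_nonneg hp _) (prob_nonneg hp _))
  have hP0 : 0 ≤ prob p (PDEvent ends u a₂ c) + prob p (TEvent ends a₂ u c) :=
    add_nonneg (prob_nonneg hp _) (prob_nonneg hp _)
  have hjoint : 0 ≤ prob p (TEvent ends a₂ u c ∩ (connEvent ends a₂ o ∩ connEvent ends a₂ b)) *
      (prob p (PDEvent ends u a₂ c) + prob p (TEvent ends a₂ u c)) :=
    mul_nonneg (prob_nonneg hp _) hP0
  rw [hid]
  nlinarith [mul_nonneg hβ hjoint, mul_nonneg hβ (sub_nonneg.2 hbL)]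

/-- **`lowK₂ / P₀ ≤ T2oK` in every case** (`P₀ = 0`: `T2oK = ℰ·e0 ≥ 0` and `lowK₂ / 0 = 0`). -/
theorem lowK2_div_le_T2oK (hp : IsProbVec p) :
    (((prob p (PDEvent ends u a₂ c) * prob p (connEvent ends a₂ b) +
            prob p (avoidAll ends a₂ {c}) * gap p ends u a₂ b) +
          (prob p Set.univ * EQb3 p ends u a₂ c b + prob p Set.univ * PDb p ends u a₂ c b +
            prob p (connEvent ends a₂ b) * EQ3 p ends u a₂ c +
            prob p (connEvent ends a₂ b) * prob p (avoidAll ends a₂ {u}) -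
            (prob p Set.univ - prob p (avoidAll ends a₂ {c})) * gap p ends u a₂ b)) *
        (prob p (TEvent ends a₂ u c) * prob p (PDEvent ends u a₂ c ∩ connEvent ends a₂ o) -
          prob p (PDEvent ends u a₂ c) * prob p (TEvent ends a₂ u c ∩ connEvent ends a₂ o)) -
      2 * (prob p Set.univ * prob p (PDEvent ends u a₂ c) +
          prob p (avoidAll ends a₂ {c}) * prob p (avoidAll ends a₂ {u})) *
        (prob p (TEvent ends a₂ u c ∩ connEvent ends a₂ b) *
          (prob p (PDEvent ends u a₂ c ∩ connEvent ends a₂ o) +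
            prob p (TEvent ends a₂ u c ∩ connEvent ends a₂ o))) +
      Ee p ends a₂ c b u *
        (prob p (avoidAll ends a₂ {c} ∩ connEvent ends a₂ o) *
            (prob p (PDEvent ends u a₂ c) + prob p (TEvent ends a₂ u c)) -
          prob p (avoidAll ends a₂ {c}) *
            (prob p (PDEvent ends u a₂ c ∩ connEvent ends a₂ o) +
              prob p (TEvent ends a₂ u c ∩ connEvent ends a₂ o)))) /
      (prob p (PDEvent ends u a₂ c) + prob p (TEvent ends a₂ u c)) ≤ T2oK p ends o a₂ c b u := by
  have hlow := lowK2_le_P0_mul_T2oK p ends o a₂ c b u hp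
  have hP0 : 0 ≤ prob p (PDEvent ends u a₂ c) + prob p (TEvent ends a₂ u c) :=
    add_nonneg (prob_nonneg hp _) (prob_nonneg hp _)
  rcases hP0.lt_or_eq with hpos | hzero
  · rw [div_le_iff₀ hpos]
    linarith [hlow]
  · have hz := hzero.symm
    rw [hz, div_zero]
    have hE := Ee_nonneg p ends a₂ c b u hp
    have he0 := prob_nonneg hp (avoidAll ends a₂ {c} ∩ connEvent ends a₂ o)
    unfold T2oK
    have h1 := prob_PD_eq_zero_of_P0 p ends a₂ c u hp hz (connEvent ends a₂ o)
    have h2 := prob_PD_eq_zero_of_P0 p ends a₂ c u hp hz (connEvent ends a₂ o ∩ connEvent ends a₂ b)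
    have h3 := prob_PD_eq_zero_of_P0 p ends a₂ c u hp hz (connEvent ends a₂ o ∩ connEvent ends u b)
    rw [h1.1, h1.2, h2.2, h3.1, h3.2]
    have := mul_nonneg hE he0
    linarith

end SecondBound

end MixK

namespace MixL

variable {V : Type*} {E : Type*} [Fintype E] [DecidableEq E] [Fintype V] [DecidableEq V]
  {R : Type*} [Field R] [LinearOrder R] [IsStrictOrderedRing R]

section SecondBound

variable (p : E → R) (ends : E → Sym2 V) (o a₂ c b u : V)

/-- **The second (marginal) lower bound of the `o ∈ L` half**: `lowL₂ = |B|·δ_o − 2β·P(T, bL)·Y + (OU)·Y ≤ W·T2oL`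
— the mirror identity with the joint mass `M·W ≥ 0` and the BHK-1.4 slack `P(R, bK)·Y − Y_bK·W ≥ 0`
(`YbK_mul_W_le`) dropped from the mixed bracket. -/
theorem lowL2_le_W_mul_T2oL (hp : IsProbVec p) :
    ((prob p Set.univ * EQb3 p ends u a₂ c b + prob p Set.univ * PDb p ends u a₂ c b +
            prob p (connEvent ends a₂ b) * EQ3 p ends u a₂ c +
            prob p (connEvent ends a₂ b) * prob p (avoidAll ends a₂ {u}) -
            (prob p Set.univ - prob p (avoidAll ends a₂ {c})) * gap p ends u a₂ b) -
          (prob p (PDEvent ends u a₂ c) * prob p (connEvent ends a₂ b) +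
            prob p (avoidAll ends a₂ {c}) * gap p ends u a₂ b)) *
        (prob p (TEvent ends u a₂ c) * prob p (PDEvent ends u a₂ c ∩ connEvent ends u o) -
          prob p (PDEvent ends u a₂ c) * prob p (TEvent ends u a₂ c ∩ connEvent ends u o)) -
      2 * (prob p Set.univ * prob p (PDEvent ends u a₂ c) +
          prob p (avoidAll ends a₂ {c}) * prob p (avoidAll ends a₂ {u})) *
        (prob p (TEvent ends u a₂ c ∩ connEvent ends u b) *
          (prob p (PDEvent ends u a₂ c ∩ connEvent ends u o) +
            prob p (TEvent ends u a₂ c ∩ connEvent ends u o))) +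
      T2oL p ends u a₂ c b u *
        (prob p (PDEvent ends u a₂ c ∩ connEvent ends u o) +
          prob p (TEvent ends u a₂ c ∩ connEvent ends u o)) ≤
    (prob p (PDEvent ends u a₂ c) + prob p (TEvent ends u a₂ c)) * T2oL p ends o a₂ c b u := by
  have hid := W_mul_T2oL_eq p ends o a₂ c b u
  have hYbK := YbK_mul_W_le p ends o a₂ c b u hp
  have hβ : 0 ≤ prob p Set.univ * prob p (PDEvent ends u a₂ c) +
      prob p (avoidAll ends a₂ {c}) * prob p (avoidAll ends a₂ {u}) :=
    add_nonneg (mul_nonneg (prob_nonneg hp _) (prob_nonneg hp _))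
      (mul_nonneg (prob_nonneg hp _) (prob_nonneg hp _))
  have hW : 0 ≤ prob p (PDEvent ends u a₂ c) + prob p (TEvent ends u a₂ c) :=
    add_nonneg (prob_nonneg hp _) (prob_nonneg hp _)
  have hM : 0 ≤ prob p (TEvent ends u a₂ c ∩ (connEvent ends u o ∩ connEvent ends u b)) *
      (prob p (PDEvent ends u a₂ c) + prob p (TEvent ends u a₂ c)) :=
    mul_nonneg (prob_nonneg hp _) hW
  rw [hid]
  nlinarith [mul_nonneg hβ hM, mul_nonneg hβ (sub_nonneg.2 hYbK)]

/-- **`lowL₂ / W ≤ T2oL` in every case** (`W = 0`: `T2oL = 0` and `lowL₂ / 0 = 0`). -/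
theorem lowL2_div_le_T2oL (hp : IsProbVec p) :
    (((prob p Set.univ * EQb3 p ends u a₂ c b + prob p Set.univ * PDb p ends u a₂ c b +
            prob p (connEvent ends a₂ b) * EQ3 p ends u a₂ c +
            prob p (connEvent ends a₂ b) * prob p (avoidAll ends a₂ {u}) -
            (prob p Set.univ - prob p (avoidAll ends a₂ {c})) * gap p ends u a₂ b) -
          (prob p (PDEvent ends u a₂ c) * prob p (connEvent ends a₂ b) +
            prob p (avoidAll ends a₂ {c}) * gap p ends u a₂ b)) *
        (prob p (TEvent ends u a₂ c) * prob p (PDEvent ends u a₂ c ∩ connEvent ends u o) -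
          prob p (PDEvent ends u a₂ c) * prob p (TEvent ends u a₂ c ∩ connEvent ends u o)) -
      2 * (prob p Set.univ * prob p (PDEvent ends u a₂ c) +
          prob p (avoidAll ends a₂ {c}) * prob p (avoidAll ends a₂ {u})) *
        (prob p (TEvent ends u a₂ c ∩ connEvent ends u b) *
          (prob p (PDEvent ends u a₂ c ∩ connEvent ends u o) +
            prob p (TEvent ends u a₂ c ∩ connEvent ends u o))) +
      T2oL p ends u a₂ c b u *
        (prob p (PDEvent ends u a₂ c ∩ connEvent ends u o) +
          prob p (TEvent ends u a₂ c ∩ connEvent ends u o))) /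
      (prob p (PDEvent ends u a₂ c) + prob p (TEvent ends u a₂ c)) ≤ T2oL p ends o a₂ c b u := by
  have hlow := lowL2_le_W_mul_T2oL p ends o a₂ c b u hp
  have hW : 0 ≤ prob p (PDEvent ends u a₂ c) + prob p (TEvent ends u a₂ c) :=
    add_nonneg (prob_nonneg hp _) (prob_nonneg hp _)
  rcases hW.lt_or_eq with hpos | hzero
  · rw [div_le_iff₀ hpos]
    linarith [hlow]
  · have hz := hzero.symm
    rw [hz, div_zero]
    have z : ∀ X : Set (Config E),
        prob p (PDEvent ends u a₂ c ∩ X) = 0 ∧ prob p (TEvent ends u a₂ c ∩ X) = 0 := by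
      intro X
      have hD := prob_nonneg hp (PDEvent ends u a₂ c)
      have hT := prob_nonneg hp (TEvent ends u a₂ c)
      have hDX := prob_inter_le_left hp (PDEvent ends u a₂ c) X
      have hTX := prob_inter_le_left hp (TEvent ends u a₂ c) X
      have hDX0 := prob_nonneg hp (PDEvent ends u a₂ c ∩ X)
      have hTX0 := prob_nonneg hp (TEvent ends u a₂ c ∩ X)
      constructor <;> linarith
    unfold T2oL
    rw [(z (connEvent ends u o)).1, (z (connEvent ends u o)).2,
      (z (connEvent ends u o ∩ connEvent ends u b)).2,
      (z (connEvent ends u o ∩ connEvent ends a₂ b)).1, (z (connEvent ends u o ∩ connEvent ends a₂ b)).2]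
    simp

end SecondBound

end MixL


end RootLeafU

end Summit.Ventures.PercRepro2
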